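import Summits.RiemannHypothesis.RiemannHypothesis.Theses.WeilComb
import Literature.NumberTheory.LFunctions.WeilExplicit
import Literature.NumberTheory.LFunctions.WeilArchimedeanMoments
import Literature.NumberTheory.LFunctions.WeilMellinBounds
import Literature.NumberTheory.LFunctions.WeilWindowSimpleEven
import Literature.NumberTheory.LFunctions.WeilMarkovQuadratic
import Literature.NumberTheory.LFunctions.WeilGroundEnergyProofs

/-!
# Stub `stub_archOffdiag` of line `helson-dirichlet-slack` for crux `WeilComb.CombSubcritical`
(item stmt-RiemannHypothesis-1025, route route-RiemannHypothesis-WeilComb)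

Off-diagonal archimedean entries of the comb autocorrelation. With `φ_ε = ε⁻¹ φ(·/ε)`
(`tsupport φ ⊆ [-1, 1]`, `ε > 0`), `ψ_ε = φ_ε ⋆ φ̃_ε` and `h = τ_x ψ_ε = ψ_ε(· − x)`, we prove
`‖W_∞(h)‖ ≤ ‖φ‖₁² (1/|x| + 1)` for `|x| ≥ 4ε`.

Proof. `h` is a Weil test function supported in `[x − 2ε, x + 2ε]`, so `h 0 = ψ_ε(−x) = 0` and
Bombieri's form of the archimedean term (`weilArchTermBombieri_eq_weilArchTerm_holds`) reads
`W_∞(h) = −∫_{t>0} K(t) (h(t) + h(−t)) dt`, `K(t) = e^{t/2}/(2 sinh t)`. For `t > 0` the values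
`h(±t)` vanish unless `t ≥ |x| − 2ε ≥ |x|/2`, and the kernel satisfies `K(t) ≤ 1/(2t) + 1` for every
`t > 0` (from `1 + y ≤ e^y`), hence `K(t) ≤ 1/|x| + 1` wherever `h(t) + h(−t) ≠ 0`. Therefore
`‖W_∞(h)‖ ≤ (1/|x| + 1) ∫_{t>0} (‖h(t)‖ + ‖h(−t)‖) dt = (1/|x| + 1) ‖h‖₁`, and
`‖h‖₁ = ‖ψ_ε‖₁ ≤ ‖φ_ε‖₁ ‖φ̃_ε‖₁ = ‖φ_ε‖₁² = ‖φ‖₁²` (Young's `L¹` inequality, i.e. Fubini, and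
the dilation invariance of the `L¹` norm).
-/

noncomputable section

open scoped BigOperators ComplexConjugate
open Complex MeasureTheory Set

namespace Summit.RiemannHypothesis.RiemannHypothesis.Theorems.WeilCombSubcritical

open Literature.NumberTheory.LFunctions

/-! ### Private toolkit: dilation, the kernel `ψ_ε`, Young's inequality, the kernel bound -/

/-- `φ_ε` is a Weil test function (`ε ≠ 0`). -/
private theorem isWeilTest_dil_offdiag {φ : ℝ → ℂ} {ε : ℝ} (hφ : IsWeilTest φ) (hε : ε ≠ 0) :
    IsWeilTest (fun t : ℝ => (ε : ℂ)⁻¹ * φ (t / ε)) := by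
  have h1 : IsWeilTest (fun t : ℝ => φ (t / ε)) := by
    refine ⟨hφ.1.comp (contDiff_id.div_const ε), ?_⟩
    have e : (fun t : ℝ => φ (t / ε)) = φ ∘ (Homeomorph.mulRight₀ ε⁻¹ (inv_ne_zero hε)) := by
      ext t
      simp [div_eq_mul_inv]
    rw [e]
    exact hφ.2.comp_homeomorph _
  exact h1.const_mul _

/-- `tsupport φ ⊆ [-1, 1]` gives `tsupport φ_ε ⊆ [-ε, ε]` (`ε > 0`). -/
private theorem tsupport_dil_subset_offdiag {φ : ℝ → ℂ} {ε : ℝ} (hsupp : tsupport φ ⊆ Icc (-1) 1)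
    (hε : 0 < ε) : tsupport (fun t : ℝ => (ε : ℂ)⁻¹ * φ (t / ε)) ⊆ Icc (-ε) ε := by
  refine closure_minimal ?_ isClosed_Icc
  intro t ht
  rw [Function.mem_support] at ht
  have hφ : φ (t / ε) ≠ 0 := fun h => ht (by simp [h])
  have hmem : t / ε ∈ Icc (-1 : ℝ) 1 := hsupp (subset_tsupport _ hφ)
  constructor
  · have h := hmem.1
    rw [le_div_iff₀ hε] at h
    linarith
  · have h := hmem.2
    rw [div_le_iff₀ hε] at h
    linarith

/-- `‖φ_ε‖₁ = ‖φ‖₁` (`ε > 0`). -/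
private theorem weilNorm1_dil_offdiag (φ : ℝ → ℂ) {ε : ℝ} (hε : 0 < ε) :
    weilNorm1 (fun t : ℝ => (ε : ℂ)⁻¹ * φ (t / ε)) = weilNorm1 φ := by
  unfold weilNorm1
  have e : (fun t : ℝ => ‖(ε : ℂ)⁻¹ * φ (t / ε)‖) = fun t => ε⁻¹ * ‖φ (t / ε)‖ := by
    funext t
    rw [norm_mul, norm_inv, Complex.norm_real, Real.norm_eq_abs, abs_of_pos hε]
  rw [e, integral_const_mul, Measure.integral_comp_div (fun t => ‖φ t‖) ε, abs_of_pos hε,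
    smul_eq_mul, ← mul_assoc, inv_mul_cancel₀ hε.ne', one_mul]

/-- `ψ_ε(s) = 0` for `|s| > 2ε`. -/
private theorem psi_eq_zero_offdiag {φ : ℝ → ℂ} {ε : ℝ} (hφ : IsWeilTest φ)
    (hsupp : tsupport φ ⊆ Icc (-1) 1) (hε : 0 < ε) {s : ℝ} (hs : 2 * ε < |s|) :
    weilConv (fun t : ℝ => (ε : ℂ)⁻¹ * φ (t / ε))
        (weilReflect (fun t : ℝ => (ε : ℂ)⁻¹ * φ (t / ε))) s = 0 := by
  have hsub : tsupport (weilConv (fun t : ℝ => (ε : ℂ)⁻¹ * φ (t / ε))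
      (weilReflect (fun t : ℝ => (ε : ℂ)⁻¹ * φ (t / ε)))) ⊆ Icc (-(2 * ε)) (2 * ε) :=
    tsupport_weilConv_weilReflect_subset (isWeilTest_dil_offdiag hφ hε.ne').2
      (tsupport_dil_subset_offdiag hsupp hε)
  refine eq_zero_of_tsupport_subset hsub fun h => ?_
  have h1 := h.1
  have h2 := h.2
  have : |s| ≤ 2 * ε := abs_le.2 ⟨h1, h2⟩
  linarith

/-- `‖g̃‖₁ = ‖g‖₁`. -/
private theorem weilNorm1_weilReflect_offdiag (g : ℝ → ℂ) :
    weilNorm1 (weilReflect g) = weilNorm1 g := by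
  unfold weilNorm1 weilReflect
  simp_rw [Complex.norm_conj]
  exact integral_neg_eq_self (fun t : ℝ => ‖g t‖) volume

/-- Young's inequality in `L¹` for continuous compactly supported functions:
`‖g ⋆ h‖₁ ≤ ‖g‖₁ ‖h‖₁` (Fubini–Tonelli, `MeasureTheory.integral_convolution`). -/
private theorem weilNorm1_weilConv_le_offdiag {g h : ℝ → ℂ} (hg : Continuous g)
    (hgs : HasCompactSupport g) (hh : Continuous h) (hhs : HasCompactSupport h) :
    weilNorm1 (weilConv g h) ≤ weilNorm1 g * weilNorm1 h := by
  unfold weilNorm1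
  have hgi : Integrable (fun x => ‖g x‖) := (hg.integrable_of_hasCompactSupport hgs).norm
  have hhi : Integrable (fun x => ‖h x‖) := (hh.integrable_of_hasCompactSupport hhs).norm
  have hconv := MeasureTheory.integral_convolution (L := ContinuousLinearMap.mul ℝ ℝ)
    (μ := volume) (ν := volume) hgi hhi
  have hpt : ∀ x, ‖weilConv g h x‖ ≤
      MeasureTheory.convolution (fun x => ‖g x‖) (fun x => ‖h x‖)
        (ContinuousLinearMap.mul ℝ ℝ) volume x := by
    intro x
    rw [weilConv_apply, convolution_def]
    simp only [ContinuousLinearMap.mul_apply']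
    refine (norm_integral_le_integral_norm _).trans (le_of_eq ?_)
    congr 1
    ext u
    rw [norm_mul]
  calc ∫ x, ‖weilConv g h x‖
      ≤ ∫ x, MeasureTheory.convolution (fun x => ‖g x‖) (fun x => ‖h x‖)
          (ContinuousLinearMap.mul ℝ ℝ) volume x :=
        integral_mono_of_nonneg (Filter.Eventually.of_forall fun _ => norm_nonneg _)
          (hgi.integrable_convolution _ hhi) (Filter.Eventually.of_forall hpt)
    _ = (∫ x, ‖g x‖) * ∫ x, ‖h x‖ := by
        rw [hconv]
        rfl

/-- The kernel bound `e^{t/2}/(2 sinh t) ≤ 1/(2t) + 1` for `t > 0`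
(from `1 + y ≤ e^y` at `y = t/2` and `y = 3t/2`). -/
private theorem archDensity_le_offdiag {t : ℝ} (ht : 0 < t) :
    Real.exp (t / 2) / (2 * Real.sinh t) ≤ 1 / (2 * t) + 1 := by
  have hs : 0 < 2 * Real.sinh t := mul_pos two_pos (Real.sinh_pos_iff.2 ht)
  rw [div_le_iff₀ hs, Real.sinh_eq]
  set u := Real.exp (t / 2) with hu
  set v := Real.exp (-(3 * t / 2)) with hv
  have hu0 : 0 < u := Real.exp_pos _
  have hv0 : 0 < v := Real.exp_pos _
  have he1 : Real.exp t = u * u := by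
    rw [hu, ← Real.exp_add]
    congr 1
    ring
  have he2 : Real.exp (-t) = u * v := by
    rw [hu, hv, ← Real.exp_add]
    congr 1
    ring
  have h1 : 1 + t / 2 ≤ u := by
    have := Real.add_one_le_exp (t / 2)
    linarith
  have h2 : v * (1 + 3 * t / 2) ≤ 1 := by
    have h3 := Real.add_one_le_exp (3 * t / 2)
    have h4 : v * Real.exp (3 * t / 2) = 1 := by
      rw [hv, ← Real.exp_add, neg_add_cancel, Real.exp_zero]
    calc v * (1 + 3 * t / 2) ≤ v * Real.exp (3 * t / 2) :=
          mul_le_mul_of_nonneg_left (by linarith) hv0.le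
      _ = 1 := h4
  rw [he1, he2]
  -- goal: `u ≤ (1/(2t) + 1) * (2 * ((u*u - u*v)/2))`
  have key : (1 + 2 * t) * v ≤ 1 + t / 2 + t ^ 2 := by
    have h3 : (1 + 2 * t) * v * (2 + 3 * t) ≤ 2 + 4 * t := by nlinarith
    have h4 : 2 + 4 * t ≤ (1 + t / 2 + t ^ 2) * (2 + 3 * t) := by nlinarith
    exact le_of_mul_le_mul_right (h3.trans h4) (by positivity)
  have key2 : 2 * t ≤ (1 + 2 * t) * (u - v) := by nlinarith
  have key3 : 1 ≤ (1 / (2 * t) + 1) * (u - v) := by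
    have e : (1 / (2 * t) + 1) = (1 + 2 * t) / (2 * t) := by
      field_simp
    rw [e, div_mul_eq_mul_div, le_div_iff₀ (by positivity), one_mul]
    exact key2
  calc u = u * 1 := (mul_one u).symm
    _ ≤ u * ((1 / (2 * t) + 1) * (u - v)) := mul_le_mul_of_nonneg_left key3 hu0.le
    _ = (1 / (2 * t) + 1) * (2 * ((u * u - u * v) / 2)) := by ring

/-- **Stub 6 — off-diagonal archimedean entries** via Bombieri's kernel: for `|x| ≥ 4ε`,
`|W_∞(τ_x ψ_ε)| ≤ ‖φ‖₁² (1/|x| + 1)`. -/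
theorem stub_archOffdiag :
    ∀ φ : ℝ → ℂ, IsWeilTest φ → tsupport φ ⊆ Set.Icc (-1) 1 →
      ∀ ε : ℝ, 0 < ε → ∀ x : ℝ, 4 * ε ≤ |x| →
        ‖weilArchTerm (weilTranslate (weilConv (fun t : ℝ => (ε : ℂ)⁻¹ * φ (t / ε))
            (weilReflect (fun t : ℝ => (ε : ℂ)⁻¹ * φ (t / ε)))) x)‖ ≤
          weilNorm1 φ ^ 2 * (1 / |x| + 1) := by
  intro φ hφ hsupp ε hε x hx
  -- notation
  set φε : ℝ → ℂ := fun t : ℝ => (ε : ℂ)⁻¹ * φ (t / ε) with hφε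
  set ψ : ℝ → ℂ := weilConv φε (weilReflect φε) with hψ
  set h : ℝ → ℂ := weilTranslate ψ x with hh
  set C : ℝ := 1 / |x| + 1 with hC
  have hφεW : IsWeilTest φε := isWeilTest_dil_offdiag hφ hε.ne'
  have hψW : IsWeilTest ψ := hφεW.weilConv hφεW.weilReflect
  have hhW : IsWeilTest h := hψW.weilTranslate x
  have hx0 : 0 < |x| := lt_of_lt_of_le (by positivity) hx
  have hC0 : 0 ≤ C := by positivity
  -- `h` vanishes where `ψ_ε` does
  have hvan : ∀ s : ℝ, 2 * ε < |s - x| → h s = 0 := fun s hs =>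
    psi_eq_zero_offdiag hφ hsupp hε hs
  have hh0 : h 0 = 0 := hvan 0 (by rw [zero_sub, abs_neg]; linarith)
  -- Step 1: Bombieri's form, `h 0 = 0`
  have hB : weilArchTerm h = -∫ t in Ioi (0 : ℝ),
      (Real.exp (t / 2) : ℂ) * (h t + h (-t)) / (2 * Real.sinh t : ℂ) := by
    rw [← weilArchTermBombieri_eq_weilArchTerm_holds hhW, weilArchTermBombieri_eq, hh0]
    simp
  -- Step 2: the pointwise bound on `(0, ∞)`
  have hpt : ∀ t : ℝ, 0 < t →
      ‖(Real.exp (t / 2) : ℂ) * (h t + h (-t)) / (2 * Real.sinh t : ℂ)‖ ≤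
        C * (‖h t‖ + ‖h (-t)‖) := by
    intro t ht
    have hsinh : 0 < Real.sinh t := Real.sinh_pos_iff.2 ht
    have hden : ‖(2 * Real.sinh t : ℂ)‖ = 2 * Real.sinh t := by
      rw [← Complex.ofReal_ofNat, ← Complex.ofReal_mul, Complex.norm_real,
        Real.norm_of_nonneg (by positivity)]
    rw [norm_div, norm_mul, Complex.norm_real, Real.norm_of_nonneg (Real.exp_pos _).le, hden]
    rw [show Real.exp (t / 2) * ‖h t + h (-t)‖ / (2 * Real.sinh t) =
      Real.exp (t / 2) / (2 * Real.sinh t) * ‖h t + h (-t)‖ by ring]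
    rcases lt_or_ge t (|x| - 2 * ε) with hlt | hge
    · -- both `h t` and `h (-t)` vanish
      have h1 : h t = 0 := hvan t (by
        have : |x| ≤ |t - x| + |t| := by
          calc |x| = |t - (t - x)| := by ring_nf
            _ ≤ |t| + |t - x| := abs_sub _ _
            _ = |t - x| + |t| := add_comm _ _
        rw [abs_of_pos ht] at this
        linarith)
      have h2 : h (-t) = 0 := hvan (-t) (by
        have : |x| ≤ |-t - x| + |t| := by
          calc |x| = |(-t) - (-t - x)| := by ring_nf
            _ ≤ |-t| + |-t - x| := abs_sub _ _
            _ = |-t - x| + |t| := by rw [abs_neg, add_comm]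
        rw [abs_of_pos ht] at this
        linarith)
      rw [h1, h2]
      simp
    · -- kernel bound
      have hK : Real.exp (t / 2) / (2 * Real.sinh t) ≤ C := by
        refine (archDensity_le_offdiag ht).trans ?_
        have h2t : |x| ≤ 2 * t := by linarith
        have : 1 / (2 * t) ≤ 1 / |x| := one_div_le_one_div_of_le hx0 h2t
        rw [hC]
        linarith
      calc Real.exp (t / 2) / (2 * Real.sinh t) * ‖h t + h (-t)‖
          ≤ C * ‖h t + h (-t)‖ := mul_le_mul_of_nonneg_right hK (norm_nonneg _)
        _ ≤ C * (‖h t‖ + ‖h (-t)‖) := mul_le_mul_of_nonneg_left (norm_add_le _ _) hC0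
  -- Step 3: integrate
  have hhi : Integrable (fun t => ‖h t‖) := (hhW.1.continuous.integrable_of_hasCompactSupport hhW.2).norm
  have hhi' : Integrable (fun t => ‖h (-t)‖) := hhi.comp_neg
  have hsum : Integrable (fun t => C * (‖h t‖ + ‖h (-t)‖)) := (hhi.add hhi').const_mul C
  have hI : ∫ t in Ioi (0 : ℝ), C * (‖h t‖ + ‖h (-t)‖) = C * weilNorm1 h := by
    rw [integral_const_mul, integral_add hhi.integrableOn hhi'.integrableOn,
      integral_comp_neg_Ioi 0 (fun t => ‖h t‖), neg_zero, add_comm,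
      intervalIntegral.integral_Iic_add_Ioi hhi.integrableOn hhi.integrableOn]
    rfl
  have hnorm1 : weilNorm1 h ≤ weilNorm1 φ ^ 2 := by
    have e1 : weilNorm1 h = weilNorm1 ψ := integral_sub_right_eq_self (fun t => ‖ψ t‖) x
    rw [e1, hψ, sq]
    refine (weilNorm1_weilConv_le_offdiag hφεW.1.continuous hφεW.2
      hφεW.weilReflect.1.continuous hφεW.weilReflect.2).trans (le_of_eq ?_)
    rw [weilNorm1_weilReflect_offdiag, hφε, weilNorm1_dil_offdiag φ hε]
  calc ‖weilArchTerm h‖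
      = ‖∫ t in Ioi (0 : ℝ), (Real.exp (t / 2) : ℂ) * (h t + h (-t)) / (2 * Real.sinh t : ℂ)‖ := by
        rw [hB, norm_neg]
    _ ≤ ∫ t in Ioi (0 : ℝ), ‖(Real.exp (t / 2) : ℂ) * (h t + h (-t)) / (2 * Real.sinh t : ℂ)‖ :=
        norm_integral_le_integral_norm _
    _ ≤ ∫ t in Ioi (0 : ℝ), C * (‖h t‖ + ‖h (-t)‖) := by
        refine integral_mono_of_nonneg (Filter.Eventually.of_forall fun _ => norm_nonneg _)
          hsum.integrableOn ?_
        exact (ae_restrict_iff' measurableSet_Ioi).2 (Filter.Eventually.of_forall fun t ht => hpt t ht)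
    _ = C * weilNorm1 h := hI
    _ ≤ C * weilNorm1 φ ^ 2 := mul_le_mul_of_nonneg_left hnorm1 hC0
    _ = weilNorm1 φ ^ 2 * (1 / |x| + 1) := by rw [hC, mul_comm]

end Summit.RiemannHypothesis.RiemannHypothesis.Theorems.WeilCombSubcritical

end
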